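import Summits.CriticalPhenomena.PercolationContinuityZ3.Theorems.PercNearOneGluingNoHeavyPcintBFibLevels
import Summits.CriticalPhenomena.PercolationContinuityZ3.Theorems.PercNearOneGluingNoHeavyPcintTFibStep
import HarnessLib

/-!
# PCINT lane, T-fibre route PHASE 3 (bond), step (6b): the size law of the breadth-first levels (chain binomial)

Cell `prim-pcint`, seat `prim-pcint-1` (gen 13); memo `run/shared/lean/prim/pcint/T-FIBRE-ROUTE.md` (PHASE 3).

**The Reed–Frost law.**  In the complete bipartite fibre with independent `p`-open edges, the number of cells reached by
`D` breadth-first levels from a level `L` (`#L = ℓ`), with `rX` unused cells on the side of `L` and `rY` on the other side, has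
the chain-binomial law `lawA p D acc ℓ rX rY` (`acc` = cells already counted): the next level has `Bin(rY, 1 - (1-p)^ℓ)` cells
(`BFib.sum_wt_nxt_eq`), independently of everything read later (disjoint key supports), whence the recursion

  `lawA (D+1) acc ℓ rX rY = Σ_x C(rY, x) (1-(1-p)^ℓ)^x ((1-p)^ℓ)^{rY-x} · lawA D (acc+ℓ) x (rY-x) rX`

and **`BFib.sum_wt_card_growL`**: `E[G(acc + #growL D L RX RY)] = Σ_u lawA p D acc #L #RX #RY u · G u`.  For the growth rule
`growB` of the cells (`…PcintBFibLevels.lean`) in `K_{n,n}` this gives a size law independent of the entry cell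
(`BFib.sum_wt_card_growB`), the hypothesis `hlaw` of `BFib.criticalProb_lfib_le_of_table`.
-/

noncomputable section

namespace Summit.CriticalPhenomena.PercolationContinuityZ3.Theorems.Pcint

namespace BFib

open Finset AdaptDom UFib

variable {Φ : Type*} [Fintype Φ] [DecidableEq Φ] {SA : Finset Φ} (p : ℝ)

/-- **The chain-binomial law** of `acc + #growL D L RX RY` (`ℓ = #L`, `rX = #RX`, `rY = #RY`), over any field (used
over `ℝ` here and over `ℚ` by the kernel checks). -/
def lawA {𝕜 : Type*} [Field 𝕜] (p : 𝕜) : ℕ → ℕ → ℕ → ℕ → ℕ → ℕ → 𝕜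
  | 0, acc, ℓ, _, _, u => if u = acc + ℓ then 1 else 0
  | D + 1, acc, ℓ, rX, rY, u => ∑ x ∈ range (rY + 1),
      (rY.choose x : 𝕜) * (1 - (1 - p) ^ ℓ) ^ x * ((1 - p) ^ ℓ) ^ (rY - x) * lawA p D (acc + ℓ) x (rY - x) rX u

/-- The side selected by a Boolean: `SA` or its complement. -/
def sideB (SA : Finset Φ) (b : Bool) : Finset Φ := if b then SA else SAᶜ

/-- Cells on opposite sides are adjacent in the complete bipartite fibre. -/
theorem adj_of_sides {b : Bool} {u w : Φ} (hu : u ∈ sideB SA b) (hw : w ∈ sideB SA (!b)) : (bipGraph SA).Adj u w := by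
  unfold sideB at hu hw
  rw [bipGraph_adj]
  cases b
  · simp only [Bool.false_eq_true, ↓reduceIte, mem_compl, Bool.not_false] at hu hw; exact Or.inr ⟨hu, hw⟩
  · simp only [↓reduceIte, Bool.not_true, Bool.false_eq_true, mem_compl] at hu hw; exact Or.inl ⟨hu, hw⟩

/-! ### The law of one level -/

omit [Fintype Φ] in
/-- The next level over `insert w R`: the hit at `w` and the next level over `R`. -/
theorem nxt_insert_eq_iff (y : Φ × Φ → Bool) (L : Finset Φ) {R : Finset Φ} {w : Φ} (hw : w ∉ R) (S : Finset Φ) :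
    nxt SA y L (insert w R) = S ↔
      ((∃ u ∈ L, (bipGraph SA).Adj u w ∧ y (ekB SA u w) = true) ↔ w ∈ S) ∧ nxt SA y L R = S.erase w := by
  have hwN : w ∉ nxt SA y L R := fun h => hw (nxt_subset y L R h)
  unfold nxt at hwN ⊢
  rw [filter_insert]
  split_ifs with hP
  · constructor
    · intro h
      refine ⟨⟨fun _ => h ▸ mem_insert_self _ _, fun _ => hP⟩, ?_⟩
      rw [← h, erase_insert hwN]
    · rintro ⟨h1, h2⟩
      rw [h2, insert_erase (h1.1 hP)]
  · constructor
    · intro h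
      have hwS : w ∉ S := h ▸ hwN
      exact ⟨⟨fun h' => absurd h' hP, fun h' => absurd h' hwS⟩, by rw [h, erase_eq_of_notMem hwS]⟩
    · rintro ⟨h1, h2⟩
      have hwS : w ∉ S := fun h' => hP (h1.2 h')
      rw [h2, erase_eq_of_notMem hwS]

/-- **The law of one level** (binomial thinning): for `S ⊆ R`, `L` and `R` on opposite sides and disjoint,
`P(nxt L R = S) = (1-(1-p)^ℓ)^{#S} ((1-p)^ℓ)^{#R-#S}`. -/
theorem sum_wt_nxt_eq {b : Bool} {L : Finset Φ} (hL : L ⊆ sideB SA b) :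
    ∀ (R S : Finset Φ), R ⊆ sideB SA (!b) → Disjoint L R → S ⊆ R →
      ∑ y : Φ × Φ → Bool, wt p y * (if nxt SA y L R = S then (1 : ℝ) else 0) =
        (1 - (1 - p) ^ L.card) ^ S.card * ((1 - p) ^ L.card) ^ (R.card - S.card) := by
  classical
  intro R
  induction R using Finset.induction_on with
  | empty =>
    intro S _ _ hS
    have hS0 : S = ∅ := subset_empty.1 hS
    subst hS0
    have hN : ∀ y : Φ × Φ → Bool, nxt SA y L ∅ = ∅ := fun y => subset_empty.1 (nxt_subset y L ∅)
    simp only [hN, if_true, mul_one, sum_wt, card_empty, pow_zero, Nat.sub_zero]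
  | insert w R hwR ih =>
    intro S hR hLR hS
    have hRside : R ⊆ sideB SA (!b) := fun v hv => hR (mem_insert_of_mem hv)
    have hwside : w ∈ sideB SA (!b) := hR (mem_insert_self _ _)
    have hLR' : Disjoint L R := Disjoint.mono_right (subset_insert _ _) hLR
    have hwL : w ∉ L := fun h => Finset.disjoint_left.1 hLR h (mem_insert_self _ _)
    have hLw : ∀ u ∈ L, (bipGraph SA).Adj u w := fun u hu => adj_of_sides (hL hu) hwside
    -- split the indicator
    have hsplit : ∀ y : Φ × Φ → Bool, (if nxt SA y L (insert w R) = S then (1 : ℝ) else 0) =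
        (if ((∃ u ∈ L, (bipGraph SA).Adj u w ∧ y (ekB SA u w) = true) ↔ w ∈ S) then (1 : ℝ) else 0) *
          (if nxt SA y L R = S.erase w then (1 : ℝ) else 0) := by
      intro y
      by_cases h : nxt SA y L (insert w R) = S
      · rw [if_pos h]
        obtain ⟨h1, h2⟩ := (nxt_insert_eq_iff y L hwR S).1 h
        rw [if_pos h1, if_pos h2, mul_one]
      · rw [if_neg h]
        by_cases h1 : ((∃ u ∈ L, (bipGraph SA).Adj u w ∧ y (ekB SA u w) = true) ↔ w ∈ S)
        · rw [if_pos h1, if_neg (fun h2 => h ((nxt_insert_eq_iff y L hwR S).2 ⟨h1, h2⟩)), mul_zero]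
        · rw [if_neg h1, zero_mul]
    simp_rw [hsplit]
    -- independence: the hit at `w` reads `keysTo L w`, the level over `R` reads keys towards `R`
    rw [sum_wt_mul_of_disjoint p (keysTo SA L w)]
    rotate_left
    · intro y y' hyy'
      have hiff := hit_congr (SA := SA) (L := L) (w := w) hyy'
      by_cases h1 : ((∃ u ∈ L, (bipGraph SA).Adj u w ∧ y (ekB SA u w) = true) ↔ w ∈ S)
      · rw [if_pos h1, if_pos (hiff.symm.trans h1)]
      · rw [if_neg h1, if_neg (fun h2 => h1 (hiff.trans h2))]
    · intro y y' hyy'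
      have : nxt SA y L R = nxt SA y' L R := by
        refine nxt_congr fun u hu v hv => hyy' _ fun hk => ?_
        unfold keysTo at hk
        obtain ⟨u', hu', hk⟩ := mem_image.1 hk
        -- `ekB u' w = ekB u v` with `v ∈ R`, `w ∉ R ∪ L`
        rcases ekB_mem (SA := SA) u' w with h1 | h1 <;> rcases ekB_mem (SA := SA) u v with h2 | h2 <;>
          rw [h1, h2] at hk <;> obtain ⟨hk1, hk2⟩ := Prod.mk.inj hk
        · exact hwR (hk2 ▸ hv)
        · exact hwL (hk2 ▸ hu)
        · exact hwL (hk1 ▸ hu)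
        · exact hwR (hk1 ▸ hv)
      rw [this]
    -- the two factors
    have hhit : ∑ y : Φ × Φ → Bool, wt p y *
        (if ((∃ u ∈ L, (bipGraph SA).Adj u w ∧ y (ekB SA u w) = true) ↔ w ∈ S) then (1 : ℝ) else 0) =
        if w ∈ S then 1 - (1 - p) ^ L.card else (1 - p) ^ L.card := by
      have hno := sum_wt_noHit (SA := SA) p hwL hLw
      by_cases hwS : w ∈ S
      · rw [if_pos hwS]
        have htot := sum_wt (V := Φ × Φ) p
        have : ∀ y : Φ × Φ → Bool, wt p y *
            (if ((∃ u ∈ L, (bipGraph SA).Adj u w ∧ y (ekB SA u w) = true) ↔ w ∈ S) then (1 : ℝ) else 0) =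
            wt p y - wt p y * (if (∃ u ∈ L, (bipGraph SA).Adj u w ∧ y (ekB SA u w) = true) then (0 : ℝ) else 1) := by
          intro y
          by_cases h : ∃ u ∈ L, (bipGraph SA).Adj u w ∧ y (ekB SA u w) = true
          · rw [if_pos (iff_of_true h hwS), if_pos h]; ring
          · rw [if_neg (fun h' => h (h'.2 hwS)), if_neg h]; ring
        simp_rw [this]
        rw [Finset.sum_sub_distrib, htot, hno]
      · rw [if_neg hwS]
        have : ∀ y : Φ × Φ → Bool,
            (if ((∃ u ∈ L, (bipGraph SA).Adj u w ∧ y (ekB SA u w) = true) ↔ w ∈ S) then (1 : ℝ) else 0) =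
            (if (∃ u ∈ L, (bipGraph SA).Adj u w ∧ y (ekB SA u w) = true) then (0 : ℝ) else 1) := by
          intro y
          by_cases h : ∃ u ∈ L, (bipGraph SA).Adj u w ∧ y (ekB SA u w) = true
          · rw [if_neg (fun h' => hwS (h'.1 h)), if_pos h]
          · rw [if_pos (iff_of_false h hwS), if_neg h]
        simp_rw [this]
        exact hno
    rw [hhit]
    by_cases hwS : w ∈ S
    · have hS' : S.erase w ⊆ R := fun v hv => by
        have hvS := mem_of_mem_erase hv
        rcases mem_insert.1 (hS hvS) with h | h
        · exact absurd h (ne_of_mem_erase hv)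
        · exact h
      rw [ih (S.erase w) hRside hLR' hS', if_pos hwS, card_erase_of_mem hwS, card_insert_of_notMem hwR]
      have h1 : 1 ≤ S.card := card_pos.2 ⟨w, hwS⟩
      obtain ⟨m, hm⟩ : ∃ m, S.card = m + 1 := ⟨S.card - 1, by omega⟩
      rw [hm, Nat.add_sub_cancel, show R.card + 1 - (m + 1) = R.card - m by omega, pow_succ]
      ring
    · have hS' : S ⊆ R := fun v hv => by
        rcases mem_insert.1 (hS hv) with h | h
        · exact absurd (h ▸ hv) hwS
        · exact h
      rw [erase_eq_of_notMem hwS, ih S hRside hLR' hS', if_neg hwS, card_insert_of_notMem hwR]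
      have h2 : S.card ≤ R.card := card_le_card hS'
      rw [show R.card + 1 - S.card = (R.card - S.card) + 1 by omega, pow_succ]
      ring

/-! ### The size law of the levels -/

/-- **The chain-binomial law of the levels**: `E_{π_p}[G(acc + #growL D L RX RY)] = Σ_u lawA p D acc #L #RX #RY u · G u`,
for `L, RX` on one side, `RY` on the other, pairwise disjoint. -/
theorem sum_wt_card_growL : ∀ (D acc : ℕ) (b : Bool) (L RX RY : Finset Φ) (G : ℕ → ℝ),
    L ⊆ sideB SA b → RX ⊆ sideB SA b → RY ⊆ sideB SA (!b) → Disjoint L RX → Disjoint L RY → Disjoint RX RY →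
    acc + L.card + RX.card + RY.card ≤ Fintype.card Φ →
      ∑ y : Φ × Φ → Bool, wt p y * G (acc + (growL SA y D L RX RY).card) =
        ∑ u ∈ range (Fintype.card Φ + 1), lawA p D acc L.card RX.card RY.card u * G u
  | 0, acc, b, L, RX, RY, G, _, _, _, _, _, _, hcard => by
    simp only [growL, lawA]
    rw [← Finset.sum_mul, sum_wt, one_mul]
    simp_rw [ite_mul, one_mul, zero_mul]
    rw [Finset.sum_ite_eq' (range (Fintype.card Φ + 1)) (acc + L.card) G, if_pos (mem_range.2 (by omega))]
  | D + 1, acc, b, L, RX, RY, G, hL, hRX, hRY, hLX, hLY, hXY, hcard => by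
    classical
    set ℓ := L.card with hℓ
    -- the cardinality recursion and the partition by the value of the next level
    have hA : ∀ y : Φ × Φ → Bool, G (acc + (growL SA y (D + 1) L RX RY).card) =
        ∑ S ∈ RY.powerset, (if nxt SA y L RY = S then (1 : ℝ) else 0) *
          G (acc + ℓ + (growL SA y D S (RY \ S) RX).card) := by
      intro y
      rw [card_growL_succ y D hLX hLY]
      simp_rw [ite_mul, one_mul, zero_mul]
      rw [Finset.sum_ite_eq (RY.powerset) (nxt SA y L RY), if_pos (mem_powerset.2 (nxt_subset y L RY))]
      congr 1; omega
    simp_rw [hA, Finset.mul_sum]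
    rw [Finset.sum_comm]
    -- each `S`: independence, the law of one level, the induction hypothesis
    have hS : ∀ S ∈ RY.powerset, ∑ y : Φ × Φ → Bool, wt p y * ((if nxt SA y L RY = S then (1 : ℝ) else 0) *
        G (acc + ℓ + (growL SA y D S (RY \ S) RX).card)) =
        (1 - (1 - p) ^ ℓ) ^ S.card * ((1 - p) ^ ℓ) ^ (RY.card - S.card) *
          ∑ u ∈ range (Fintype.card Φ + 1), lawA p D (acc + ℓ) S.card (RY.card - S.card) RX.card u * G u := by
      intro S hSp
      have hSR : S ⊆ RY := mem_powerset.1 hSp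
      rw [sum_wt_mul_of_disjoint p (keysLR SA L RY)]
      rotate_left
      · intro y y' hyy'
        have : nxt SA y L RY = nxt SA y' L RY :=
          nxt_congr fun u hu w hw => hyy' _ (mem_image.2 ⟨(u, w), mem_product.2 ⟨hu, hw⟩, rfl⟩)
        rw [this]
      · intro y y' hyy'
        have hdisj : Disjoint L (RY ∪ RX) := disjoint_union_right.2 ⟨hLY, hLX⟩
        have : growL SA y D S (RY \ S) RX = growL SA y' D S (RY \ S) RX := by
          refine growL_congr D _ _ _ fun u hu w hw => hyy' _ (ekB_not_mem_keysLR (SA := SA) hdisj ?_ ?_)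
          · rcases mem_union.1 hu with hu | hu
            · rcases mem_union.1 hu with hu | hu
              · exact mem_union_left _ (hSR hu)
              · exact mem_union_left _ (sdiff_subset hu)
            · exact mem_union_right _ hu
          · rcases mem_union.1 hw with hw | hw
            · rcases mem_union.1 hw with hw | hw
              · exact mem_union_left _ (hSR hw)
              · exact mem_union_left _ (sdiff_subset hw)
            · exact mem_union_right _ hw
        rw [this]
      rw [sum_wt_nxt_eq p hL RY S hRY hLY hSR]
      congr 1
      have hb : sideB SA (!!b) = sideB SA b := by rw [Bool.not_not]
      have hSX : Disjoint S RX := (Disjoint.mono_left hSR hXY.symm)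
      have h := sum_wt_card_growL D (acc + ℓ) (!b) S (RY \ S) RX G (hSR.trans hRY)
        (sdiff_subset.trans hRY) (hb ▸ hRX) disjoint_sdiff hSX (Disjoint.mono_left sdiff_subset hXY.symm)
        (by rw [card_sdiff_of_subset hSR]; have := card_le_card hSR; omega)
      rw [card_sdiff_of_subset hSR] at h
      exact h
    rw [Finset.sum_congr rfl hS]
    -- group by the size of `S`
    rw [TFib.sum_powerset_card_eq RY (fun x => (1 - (1 - p) ^ ℓ) ^ x * ((1 - p) ^ ℓ) ^ (RY.card - x) *
      ∑ u ∈ range (Fintype.card Φ + 1), lawA p D (acc + ℓ) x (RY.card - x) RX.card u * G u)]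
    -- unfold the law at depth `D + 1`
    simp only [lawA]
    simp_rw [Finset.mul_sum, Finset.sum_mul]
    rw [Finset.sum_comm]
    exact Finset.sum_congr rfl fun u _ => Finset.sum_congr rfl fun x _ => by ring

/-- **The size law of the growth rule in `K_{n,n}` does not depend on the entry cell**:
`E_{π_p}[G(#growB D y i)] = Σ_u lawA p D 0 1 (n-1) n u · G u` when both sides have `n` cells. -/
theorem sum_wt_card_growB {n : ℕ} (hA : SA.card = n) (hB : SAᶜ.card = n) (D : ℕ) (i : Φ) (G : ℕ → ℝ) :
    ∑ y : Φ × Φ → Bool, wt p y * G (growB SA D y i).card =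
      ∑ u ∈ range (Fintype.card Φ + 1), lawA p D 0 1 (n - 1) n u * G u := by
  have hcardΦ : Fintype.card Φ = n + n := by
    rw [← Finset.card_add_card_compl SA, hA, hB]
  unfold growB
  by_cases hi : i ∈ SA
  · have hside : sideOf SA i = SA := by unfold sideOf; rw [if_pos hi]
    have hother : otherSide SA i = SAᶜ := by unfold otherSide; rw [if_pos hi]
    rw [hside, hother]
    have h := sum_wt_card_growL p D 0 true {i} (SA.erase i) SAᶜ G
      (by intro j hj; rw [mem_singleton] at hj; subst hj; exact hi) (fun j hj => mem_of_mem_erase hj)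
      (by intro j hj; exact hj)
      (disjoint_singleton_left.2 (notMem_erase i SA))
      (disjoint_singleton_left.2 (fun h => (mem_compl.1 h) hi))
      (Disjoint.mono_left (erase_subset i SA) disjoint_compl_right)
      (by rw [card_singleton, card_erase_of_mem hi, hA, hB, hcardΦ]; have : 1 ≤ n := card_pos.2 ⟨i, hi⟩ |>.trans_eq hA; omega)
    simp only [zero_add, card_singleton, card_erase_of_mem hi, hA, hB] at h
    exact h
  · have hi' : i ∈ SAᶜ := mem_compl.2 hi
    have hside : sideOf SA i = SAᶜ := by unfold sideOf; rw [if_neg hi]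
    have hother : otherSide SA i = SA := by unfold otherSide; rw [if_neg hi]
    rw [hside, hother]
    have h := sum_wt_card_growL p D 0 false {i} (SAᶜ.erase i) SA G
      (by intro j hj; rw [mem_singleton] at hj; subst hj; exact hi') (fun j hj => mem_of_mem_erase hj)
      (by intro j hj; exact hj)
      (disjoint_singleton_left.2 (notMem_erase i SAᶜ))
      (disjoint_singleton_left.2 hi)
      (Disjoint.mono_left (erase_subset i SAᶜ) disjoint_compl_left)
      (by rw [card_singleton, card_erase_of_mem hi', hA, hB, hcardΦ]; have : 1 ≤ n := card_pos.2 ⟨i, hi'⟩ |>.trans_eq hB; omega)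
    simp only [zero_add, card_singleton, card_erase_of_mem hi', hA, hB] at h
    exact h

end BFib

end Summit.CriticalPhenomena.PercolationContinuityZ3.Theorems.Pcint

end
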